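import Mathlib
import Summits.Ventures.PercRepro2.Defs
import Summits.Ventures.PercRepro2.Independence
import Summits.Ventures.PercRepro2.Harris
import Summits.Ventures.PercRepro2.CoinDefs
import Summits.Ventures.PercRepro2.CoinInduced
import Summits.Ventures.PercRepro2.CoinVdBK
import Summits.Ventures.PercRepro2.CoinPin

/-!
# Row 2′DARC is AFFINE in the probability of an unseen coin; a random pre-head arm reduces to the
sure arm (blind cell PercRepro2, night-2 g6; proofs/NIGHT2-DARC.md §29)

Two structural facts about the cleared gate functional `phiC p arcs s T a b (gateEvent …)`:

* **Pinning / interpolation** (`phiC_eq_pin_of_dependsOn`, `darc_of_pin_of_dependsOn`): if the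
  avoidance event `R_T` and the two markers do not depend on the coin `e` (the coin is never seen
  by the forward cluster of `s`), then `Φ(E)` is an AFFINE function of `p e`:
  `Φ_p(E) = p e · Φ_{p[e↦1]}(E) + (1 − p e) · Φ_{p[e↦0]}(E)`, because the centring means are the same
  in the three systems and the gate masses obey the pinning identity `expect_eq_pin`.  Hence row
  2′DARC at `p` follows from the row at `p[e↦1]` and at `p[e↦0]`.
* **A pre-head arm** (`darc_of_preHead`): if the coin `e = {w → v₀}` is the ONLY coin with an arc
  out of `w`, and NO coin has an arc into `w` (`w ≠ s`, `w ∉ T`), then the `p[e↦0]` system has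
  `gate = R_T` (the gate functional is `P(R)·covC(R) ≥ 0`, directed BHK `covC_nonneg`), and in the
  `p[e↦1]` system the gate `u → w` has the same functional as the gate `u → v₀`
  (`phiC_gate_eq_of_sureArc`).  So **row 2′DARC at the arc `u → w` for every arm probability
  follows from the row at the arc `u → v₀` in the system with the arm sure.**

Consequence (§29): every head reached from `w` only through one random arm into a head `v₀` that
satisfies a landed theorem (`darc_of_forestHead_mixed` with `v₀` as its head) is a theorem — in
particular the DIAMOND `w → v₀ → {v₁, v₂} → t` (inner arcs of any probabilities, entries into
`v₀, v₁, v₂, t` arbitrary, none into `w`), the first head with an OR-vertex in the kernel; §28 shows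
why entries into `w` are exactly what this argument cannot absorb.
-/

namespace Summit.Ventures.PercRepro2.Coin

open Classical

/-! ### The gate of a pre-head arm: transfer along the sure arc, collapse when it is closed -/

section PreHead

variable {V : Type*} {E : Type*}

/-- With the arm `w → v₀` open, `w ∈ K⁻ ↔ v₀ ∈ K⁻` when the arm is the only coin leaving `w` and
`w ∉ T`. -/
lemma bwdEvent_iff_of_sureArc {arcs : E → Finset (V × V)} {e : E} {w v₀ : V}
    (he : arcs e = {(w, v₀)}) (hout : ∀ e', (∃ xy ∈ arcs e', xy.1 = w) → e' = e)
    {T : Finset V} (hwT : w ∉ T) {ω : Config E} (hω : ω e = true) :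
    ω ∈ bwdEvent arcs w T ↔ ω ∈ bwdEvent arcs v₀ T := by
  simp only [bwdEvent, Set.mem_setOf_eq]
  constructor
  · rintro ⟨t, ht, hwt⟩
    refine ⟨t, ht, ?_⟩
    rcases Relation.ReflTransGen.cases_head hwt with h | ⟨y, ⟨e', he', hmem⟩, hyt⟩
    · exact absurd (h ▸ ht) hwT
    · have hee : e' = e := hout e' ⟨_, hmem, rfl⟩
      subst hee
      rw [he, Finset.mem_singleton] at hmem
      obtain ⟨_, rfl⟩ := Prod.mk.inj hmem
      exact hyt
  · rintro ⟨t, ht, hvt⟩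
    refine ⟨t, ht, reach_trans (reach_of_openArc ⟨e, hω, ?_⟩) hvt⟩
    rw [he]
    exact Finset.mem_singleton_self _

/-- With the arm `w → v₀` closed, `w ∉ K⁻`. -/
lemma not_bwdEvent_of_closedArc {arcs : E → Finset (V × V)} {e : E} {w : V}
    (hout : ∀ e', (∃ xy ∈ arcs e', xy.1 = w) → e' = e) {T : Finset V} (hwT : w ∉ T)
    {ω : Config E} (hω : ω e = false) : ω ∉ bwdEvent arcs w T := by
  rintro ⟨t, ht, hwt⟩
  rcases Relation.ReflTransGen.cases_head hwt with h | ⟨y, ⟨e', he', hmem⟩, _⟩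
  · exact hwT (h ▸ ht)
  · have hee : e' = e := hout e' ⟨_, hmem, rfl⟩
    subst hee
    rw [hω] at he'
    exact Bool.false_ne_true he'

/-- With the arm open, the gate `u → w` is the gate `u → v₀`. -/
lemma gateEvent_iff_of_sureArc {arcs : E → Finset (V × V)} {e : E} {w v₀ : V}
    (he : arcs e = {(w, v₀)}) (hout : ∀ e', (∃ xy ∈ arcs e', xy.1 = w) → e' = e)
    (s : V) {T : Finset V} (hwT : w ∉ T) (u : V) {ω : Config E} (hω : ω e = true) :
    ω ∈ gateEvent arcs s T u w ↔ ω ∈ gateEvent arcs s T u v₀ := by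
  rw [gateEvent_eq_union, gateEvent_eq_union]
  simp only [Set.mem_inter_iff, Set.mem_union, Set.mem_compl_iff]
  rw [bwdEvent_iff_of_sureArc he hout hwT hω]

/-- With the arm closed, the gate `u → w` is the avoidance event `R_T`. -/
lemma gateEvent_iff_of_closedArc {arcs : E → Finset (V × V)} {e : E} {w : V}
    (hout : ∀ e', (∃ xy ∈ arcs e', xy.1 = w) → e' = e) (s : V) {T : Finset V} (hwT : w ∉ T)
    (u : V) {ω : Config E} (hω : ω e = false) :
    ω ∈ gateEvent arcs s T u w ↔ ω ∈ avoidEvent arcs s T := by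
  rw [gateEvent_eq_union]
  simp only [Set.mem_inter_iff, Set.mem_union, Set.mem_compl_iff]
  exact ⟨fun h => h.1, fun h => ⟨h, Or.inr (not_bwdEvent_of_closedArc hout hwT hω)⟩⟩

end PreHead

/-! ### Masses only see the configurations of positive weight -/

section Sure

variable {V : Type*} {E : Type*} [Fintype E] [DecidableEq E] {R : Type*} [CommRing R]

/-- A sure coin makes the configurations where it is closed null. -/
lemma weight_eq_zero_of_sure {p : E → R} {e : E} (hp : p e = 1) {ω : Config E}
    (h : ω e = false) : weight p ω = 0 := by
  rw [weight_eq_mul_edgeFactor p ω e]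
  simp [h, hp]

/-- A null coin makes the configurations where it is open null. -/
lemma weight_eq_zero_of_null {p : E → R} {e : E} (hp : p e = 0) {ω : Config E}
    (h : ω e = true) : weight p ω = 0 := by
  rw [weight_eq_mul_edgeFactor p ω e]
  simp [h, hp]

/-- Two events agreeing where a sure coin is open have the same restricted expectations. -/
lemma massE_congr_of_sure (p : E → R) (f : Config E → R) {e : E} (hp : p e = 1)
    {A B : Set (Config E)} (h : ∀ ω, ω e = true → (ω ∈ A ↔ ω ∈ B)) :
    massE p f A = massE p f B := by
  unfold massE expect
  refine Finset.sum_congr rfl fun ω _ => ?_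
  by_cases hω : ω e = true
  · by_cases hA : ω ∈ A
    · rw [Set.indicator_of_mem hA, Set.indicator_of_mem ((h ω hω).mp hA)]
    · rw [Set.indicator_of_notMem hA, Set.indicator_of_notMem (fun hB => hA ((h ω hω).mpr hB))]
  · simp only [Bool.not_eq_true] at hω
    rw [weight_eq_zero_of_sure hp hω, zero_mul, zero_mul]

/-- Two events agreeing where a null coin is closed have the same restricted expectations. -/
lemma massE_congr_of_null (p : E → R) (f : Config E → R) {e : E} (hp : p e = 0)
    {A B : Set (Config E)} (h : ∀ ω, ω e = false → (ω ∈ A ↔ ω ∈ B)) :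
    massE p f A = massE p f B := by
  unfold massE expect
  refine Finset.sum_congr rfl fun ω _ => ?_
  by_cases hω : ω e = true
  · rw [weight_eq_zero_of_null hp hω, zero_mul, zero_mul]
  · simp only [Bool.not_eq_true] at hω
    by_cases hA : ω ∈ A
    · rw [Set.indicator_of_mem hA, Set.indicator_of_mem ((h ω hω).mp hA)]
    · rw [Set.indicator_of_notMem hA, Set.indicator_of_notMem (fun hB => hA ((h ω hω).mpr hB))]

/-- The cleared gate functional only sees the events where a sure coin is open. -/
lemma phiC_congr_of_sure (p : E → R) (arcs : E → Finset (V × V)) (s : V) (T : Finset V) (a b : V)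
    {e : E} (hp : p e = 1) {A B : Set (Config E)} (h : ∀ ω, ω e = true → (ω ∈ A ↔ ω ∈ B)) :
    phiC p arcs s T a b A = phiC p arcs s T a b B := by
  simp only [phiC, prob_eq_massE_one]
  rw [massE_congr_of_sure p _ hp h, massE_congr_of_sure p (marker arcs s a) hp h,
    massE_congr_of_sure p (marker arcs s b) hp h, massE_congr_of_sure p (fun _ => 1) hp h]

/-- The cleared gate functional only sees the events where a null coin is closed. -/
lemma phiC_congr_of_null (p : E → R) (arcs : E → Finset (V × V)) (s : V) (T : Finset V) (a b : V)
    {e : E} (hp : p e = 0) {A B : Set (Config E)} (h : ∀ ω, ω e = false → (ω ∈ A ↔ ω ∈ B)) :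
    phiC p arcs s T a b A = phiC p arcs s T a b B := by
  simp only [phiC, prob_eq_massE_one]
  rw [massE_congr_of_null p _ hp h, massE_congr_of_null p (marker arcs s a) hp h,
    massE_congr_of_null p (marker arcs s b) hp h, massE_congr_of_null p (fun _ => 1) hp h]

/-- On the avoidance event itself the cleared functional is `P(R_T) · covC(R_T)`. -/
lemma phiC_avoidEvent (p : E → R) (arcs : E → Finset (V × V)) (s : V) (T : Finset V) (a b : V) :
    phiC p arcs s T a b (avoidEvent arcs s T) =
      prob p (avoidEvent arcs s T) * covC p arcs s a b (avoidEvent arcs s T) := by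
  simp only [phiC, covC]
  ring

end Sure

/-! ### The theorem: a random pre-head arm reduces to the sure arm -/

section Theorem

variable {V : Type*} {E : Type*} [Fintype V] [DecidableEq V] [Fintype E] [DecidableEq E]
  {R : Type*} [CommRing R] [LinearOrder R] [IsStrictOrderedRing R]

omit [Fintype E] in
/-- A probability vector stays one after pinning a coin to `1`. -/
lemma isProbVec_update_one {p : E → R} (hp : IsProbVec p) (e : E) :
    IsProbVec (Function.update p e 1) := by
  refine ⟨fun e' => ?_, fun e' => ?_⟩
  · by_cases h : e' = e
    · subst h; simp
    · rw [Function.update_of_ne h]; exact hp.nonneg e'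
  · by_cases h : e' = e
    · subst h; simp
    · rw [Function.update_of_ne h]; exact hp.le_one e'

omit [Fintype E] in
/-- A probability vector stays one after pinning a coin to `0`. -/
lemma isProbVec_update_zero {p : E → R} (hp : IsProbVec p) (e : E) :
    IsProbVec (Function.update p e 0) := by
  refine ⟨fun e' => ?_, fun e' => ?_⟩
  · by_cases h : e' = e
    · subst h; simp
    · rw [Function.update_of_ne h]; exact hp.nonneg e'
  · by_cases h : e' = e
    · subst h; simp
    · rw [Function.update_of_ne h]; exact hp.le_one e'

/-- **Row 2′DARC at a random pre-head arm reduces to the sure arm.**  Let the coin `e = {w → v₀}`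
be the only coin with an arc out of `w`, let no coin have an arc into `w`, `w ≠ s`, `w ∉ T`.  If row
2′DARC holds at the arc `u → v₀` in the system with the arm pinned open, it holds at the arc
`u → w` in the system with the arm of probability `p e` (any value in `[0, 1]`).  Proof: the gate
functional is affine in `p e` (`phiC_eq_pin_of_dependsOn`); pinned closed it is `P(R)·covC(R) ≥ 0`
(directed BHK); pinned open the gate `u → w` is the gate `u → v₀`. -/
theorem darc_of_preHead (p : E → R) (hp : IsProbVec p) {arcs : E → Finset (V × V)}
    (hS : SameEnds arcs) (s : V) (T : Finset V) (a b u w v₀ : V) (e : E)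
    (he : arcs e = {(w, v₀)}) (hin : ∀ e', ∀ xy ∈ arcs e', xy.2 ≠ w)
    (hout : ∀ e', (∃ xy ∈ arcs e', xy.1 = w) → e' = e) (hs : s ≠ w) (hwT : w ∉ T)
    (hsure : DARC (Function.update p e 1) arcs s T a b u v₀) :
    DARC p arcs s T a b u w := by
  have he' : ∀ xy ∈ arcs e, xy.1 = w := fun xy hxy => by
    rw [he, Finset.mem_singleton] at hxy
    subst hxy
    rfl
  refine darc_of_pin_of_dependsOn p arcs s T a b u w e (hp.nonneg e) (hp.le_one e)
    (dependsOn_avoidEvent_of_unentered hin he' hs T)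
    (dependsOn_marker_of_unentered hin he' hs a) (dependsOn_marker_of_unentered hin he' hs b)
    ?_ ?_
  · -- pinned open: the gate `u → w` is the gate `u → v₀`
    unfold DARC at hsure ⊢
    rw [phiC_congr_of_sure (Function.update p e 1) arcs s T a b (by simp)
      (fun ω hω => gateEvent_iff_of_sureArc he hout s hwT u hω)]
    exact hsure
  · -- pinned closed: the gate is `R_T`, and the functional is `P(R)·covC(R) ≥ 0`
    unfold DARC
    rw [phiC_congr_of_null (Function.update p e 0) arcs s T a b (by simp)
      (fun ω hω => gateEvent_iff_of_closedArc hout s hwT u hω), phiC_avoidEvent]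
    exact mul_nonneg (prob_nonneg (isProbVec_update_zero hp e) _)
      (covC_nonneg _ (isProbVec_update_zero hp e) hS s a b T)

end Theorem

end Summit.Ventures.PercRepro2.Coin
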